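import Mathlib
import Literature.Analysis.FluidPDE.VectorCalculus
import Literature.Analysis.FunctionSpaces.SobolevDomain
import HarnessLib

/-!
# Self-equilibration of discretely self-similar pressure-free weak Euler cones

Analysis/FluidPDE support file (serves the point-sink route of the anomalous-dissipation summit).
A discretely self-similar (DSS) cone is a field `V : ℝ³ → ℝ³` with `V (λx) = λ^{-2/3} V x` for ONE
`λ > 1` (`x ≠ 0`), square integrable off the origin, solving the stationary Euler equations weakly
and PRESSURE-FREE off the origin: `∫ ⟪V, Dφ·V⟫ = 0` for every smooth divergence-free `φ` compactly
supported in `ℝ³ ∖ {0}`. At the Onsager-critical homogeneity `-2/3` such a cone is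
*self-equilibrated*: its momentum flux `∮_{S_ρ}(V⟪V,n⟫ + Pn)` and torque flux
`∮_{S_ρ} x × (V⟪V,n⟫ + Pn)` through spheres vanish — by the weak equation they are independent of
`ρ`, by self-similarity they scale like `ρ^{2-4/3}`, `ρ^{3-4/3}` (cf. Shvydkoy 2018, §6, for smooth
homogeneous solutions). These are the vanishing-Killing-moment compatibility conditions of
compactly supported symmetric anti-divergence correctors on shells (Mao–Oh–Tao 2023, Lemma 2.2;
tree `Literature.Geometry.Lorentzian.MaoOhTao.sum_pd_annulusT_eq`). Proved here in PRESSURE-FREE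
form (for such rough `V` the pressure is only a distribution and never appears):

* `DSSEulerCone.pairing_eq_zero` — `∫ ⟪V, Dw·V⟫ = 0` for every smooth divergence-free `w` vanishing
  near the origin and eventually `(λ, c)`-invariant (`c • w (λx) = w x` for large `x`, `c ≤ 1`):
  `c = 1`, `w = a` near infinity is the momentum flux; `c = λ⁻¹`, `w = A x` (`A` skew) the torque
  flux. Proof: `w - c w(λ·)` is an admissible test field, and the change of variables `x ↦ λx` plus
  self-similarity give `∫⟪V, D(c w(λ·)) V⟫ = c λ^{-2/3} ∫⟪V, Dw V⟫` with `c λ^{-2/3} < 1`.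
* `DSSEulerCone.torqueFlux_eq_zero` — the radial-weight form `∫ g'(‖x‖²) ⟪V x, x⟫ ⟪V x, A x⟫ = 0`
  for skew `A` and every smooth profile `g` vanishing near `0` and constant near infinity (so `g'`
  is an ARBITRARY element of `C_c^∞(0,∞)`), with the calculus of the rotational test fields
  `x ↦ g(‖x‖²) A x` (`fderiv_radial_smul_skew`, `divergence_radial_smul_skew`).
* `DSSEulerCone.velocity_inv_smul` — backward self-similarity `V (λ⁻¹y) = λ^{2/3} V y`. The finite
  local energy `|V|² ∈ L¹(B₁)` of such cones is the companion file `SelfSimilarEulerConeEnergy`.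

## Mathlib / tree search

Mathlib (this pin): `Measure.integral_comp_smul`, `Integrable.comp_smul`, `fderiv_comp_smul`,
`hasStrictFDerivAt_norm_sq`, `OrthonormalBasis.sum_inner_mul_inner`; nothing on self-similar or
weak Euler fields. Tree: `HomogeneousEuler(Flux).lean` (Shvydkoy's `C¹` homogeneous class, all
dilations, with pressure — not applicable to rough DSS pressure-free cones); `IsTestFunctionOn`
(`SobolevDomain`), `VectorCalculus.divergence`, `divergence_eq_sum_inner_fderiv` reused; the
bookkeeping `divergence_sub'` (`SteadyNSCaccioppoli`), `divergence_const_smul_apply`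
(`PressurePoisson`) live in heavier files and are re-proved privately. No definitions, no named
facts.

## References

* R. Shvydkoy, *Homogeneous solutions to the 3D Euler system*, Trans. Amer. Math. Soc. 370 (2018)
  2517–2535, §6 (fluxes of homogeneous solutions through spheres). [`Shvydkoy2018`]
* Y. Mao, S.-J. Oh, T. Tao, arXiv:2308.13031 (2023), Lemma 2.2 (vanishing Killing moments).
  [`MaoOhTao2023`]
* C. De Lellis, L. Székelyhidi Jr., Bull. Amer. Math. Soc. 49 (2012), §2.2 (weak stationary Euler).
  [`DeLellisSzekelyhidi2012BAMS`]
-/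

noncomputable section

open MeasureTheory Filter Topology Set Metric
open scoped InnerProductSpace ContDiff Pointwise
open Literature.Analysis.FunctionSpaces

namespace Literature.Analysis.FluidPDE

namespace DSSEulerCone

/-- Physical space `ℝ³`. -/
local notation "ℝ³" => EuclideanSpace ℝ (Fin 3)

/-- Backward form of discrete self-similarity: `V (λ⁻¹ y) = λ^{2/3} V y` off the origin.
[folklore] -/
theorem velocity_inv_smul {lam : ℝ} {V : ℝ³ → ℝ³} (hlam : 1 < lam)
    (hDSS : ∀ x : ℝ³, x ≠ 0 → V (lam • x) = lam ^ (-(2 / 3 : ℝ)) • V x) {y : ℝ³} (hy : y ≠ 0) :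
    V (lam⁻¹ • y) = lam ^ (2 / 3 : ℝ) • V y := by
  have hlam0 : (0 : ℝ) < lam := by linarith
  have hy' : lam⁻¹ • y ≠ 0 := by
    simpa [smul_eq_zero, inv_eq_zero, hlam0.ne'] using hy
  have h := hDSS (lam⁻¹ • y) hy'
  rw [smul_smul, mul_inv_cancel₀ hlam0.ne', one_smul] at h
  rw [h, smul_smul, ← Real.rpow_add hlam0]
  norm_num

/-- Chain rule for the rescaled field `x ↦ c • w (λ x)`: `D(c w(λ·))(x) = c λ (Dw)(λ x)`.
[folklore] -/
private theorem fderiv_const_smul_comp_smul {w : ℝ³ → ℝ³} (hw : Differentiable ℝ w) (c lam : ℝ)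
    (x : ℝ³) :
    fderiv ℝ (fun y => c • w (lam • y)) x = (c * lam) • fderiv ℝ w (lam • x) := by
  have hd : DifferentiableAt ℝ (fun y => w (lam • y)) x := by fun_prop
  rw [fderiv_fun_const_smul hd, mul_smul]
  congr 1
  exact fderiv_comp_smul lam

/-- The divergence of the rescaled field `x ↦ c • w (λ x)` is `c λ (div w)(λ x)`. [folklore] -/
private theorem divergence_const_smul_comp_smul {w : ℝ³ → ℝ³} (hw : Differentiable ℝ w) (c lam : ℝ)
    (x : ℝ³) :
    VectorCalculus.divergence (fun y => c • w (lam • y)) x =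
      c * lam * VectorCalculus.divergence w (lam • x) := by
  unfold VectorCalculus.divergence
  rw [fderiv_const_smul_comp_smul hw, ContinuousLinearMap.toLinearMap_smul, map_smul, smul_eq_mul]

/-- The divergence of a difference of differentiable fields. [folklore] -/
private theorem divergence_sub {v w : ℝ³ → ℝ³} (hv : Differentiable ℝ v) (hw : Differentiable ℝ w)
    (x : ℝ³) :
    VectorCalculus.divergence (fun y => v y - w y) x =
      VectorCalculus.divergence v x - VectorCalculus.divergence w x := by
  unfold VectorCalculus.divergence
  rw [fderiv_fun_sub (hv x) (hw x), ContinuousLinearMap.toLinearMap_sub, map_sub]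

/-- `λ · λ⁻³ · λ^{4/3} = λ^{-2/3}` for `λ > 0` (the Jacobian bookkeeping of the DSS scaling).
[folklore] -/
private theorem jacobian_factor {lam : ℝ} (hlam0 : 0 < lam) :
    lam * ((lam ^ 3)⁻¹ * lam ^ (4 / 3 : ℝ)) = lam ^ (-(2 / 3 : ℝ)) := by
  have h3 : (lam ^ 3 : ℝ) = lam ^ (3 : ℝ) := by
    rw [show (3 : ℝ) = ((3 : ℕ) : ℝ) by norm_num, Real.rpow_natCast]
  rw [h3, ← Real.rpow_neg hlam0.le, ← Real.rpow_add hlam0, mul_comm, ← Real.rpow_add_one hlam0.ne']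
  norm_num

/-! ## Self-equilibration (zero momentum flux and zero torque flux, pressure-free form) -/

/-- **Self-equilibration of a pressure-free DSS weak Euler cone.** Let `V` be discretely
self-similar of degree `-2/3` (`V (λx) = λ^{-2/3} V x`, `λ > 1`) and a pressure-free weak steady
Euler field off the origin (`∫ ⟪V, Dφ·V⟫ = 0` for every smooth divergence-free `φ` compactly
supported in `ℝ³ ∖ {0}`). Then `∫ ⟪V, Dw·V⟫ = 0` also for every smooth divergence-free `w` that
vanishes near the origin and is *eventually `(λ, c)`-invariant*, `c • w (λ x) = w x` for `‖x‖ ≥ R₀`,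
with `c ≤ 1` (provided the pairing is integrable). With `w = a` (a constant) near infinity and
`c = 1` this is the vanishing of the total MOMENTUM FLUX of the cone through every sphere; with
`w = A x` (`A` skew) near infinity and `c = λ⁻¹` it is the vanishing of the TORQUE FLUX: the two
compatibility conditions (vanishing Killing moments) for compactly supported symmetric
anti-divergence correctors on shells (Mao–Oh–Tao 2023, Lemma 2.2), here WITHOUT a pressure
(Shvydkoy 2018, §6, discusses the fluxes of smooth homogeneous solutions). Proof: `w - c w(λ·)`
is an admissible test field, and by the change of variables `x ↦ λx` and self-similarity
`∫ ⟪V, D(c w(λ·)) V⟫ = c λ^{-2/3} ∫ ⟪V, Dw V⟫`; since `c λ^{-2/3} < 1` the pairing vanishes.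
[folklore] -/
theorem pairing_eq_zero {lam : ℝ} {V : ℝ³ → ℝ³} (hlam : 1 < lam)
    (hDSS : ∀ x : ℝ³, x ≠ 0 → V (lam • x) = lam ^ (-(2 / 3 : ℝ)) • V x)
    (hEuler : ∀ φ : ℝ³ → ℝ³, IsTestFunctionOn ⟨{x : ℝ³ | x ≠ 0}, isOpen_ne⟩ φ →
      (∀ x, VectorCalculus.divergence φ x = 0) → ∫ x, ⟪V x, fderiv ℝ φ x (V x)⟫_ℝ = 0)
    {w : ℝ³ → ℝ³} (hw : ContDiff ℝ ∞ w) (hdiv : ∀ x, VectorCalculus.divergence w x = 0)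
    {c : ℝ} (hc1 : c ≤ 1)
    (h0 : ∃ δ : ℝ, 0 < δ ∧ ∀ x : ℝ³, ‖x‖ < δ → w x = 0)
    (hinf : ∃ R₀ : ℝ, ∀ x : ℝ³, R₀ ≤ ‖x‖ → c • w (lam • x) = w x)
    (hint : Integrable (fun x => ⟪V x, fderiv ℝ w x (V x)⟫_ℝ)) :
    ∫ x, ⟪V x, fderiv ℝ w x (V x)⟫_ℝ = 0 := by
  have hlam0 : (0 : ℝ) < lam := by linarith
  obtain ⟨δ, hδ, hδw⟩ := h0
  obtain ⟨R₀, hR₀⟩ := hinf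
  have hwd : Differentiable ℝ w := hw.differentiable (by simp)
  -- the rescaled field and its derivative
  set wl : ℝ³ → ℝ³ := fun y => c • w (lam • y) with hwl_def
  have hwl : ContDiff ℝ ∞ wl := (hw.comp (contDiff_id.const_smul lam)).const_smul c
  have hwld : Differentiable ℝ wl := hwl.differentiable (by simp)
  have hfd : ∀ x h : ℝ³, fderiv ℝ wl x h = (c * lam) • fderiv ℝ w (lam • x) h := fun x h => by
    rw [fderiv_const_smul_comp_smul hwd c lam x]
    rfl
  -- the difference `φ = w - wl` is an admissible test field
  set φ : ℝ³ → ℝ³ := fun y => w y - wl y with hφ_def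
  have hφ_far : ∀ x : ℝ³, R₀ ≤ ‖x‖ → φ x = 0 := fun x hx => by
    simp [hφ_def, hwl_def, hR₀ x hx]
  have hφ_near : ∀ x : ℝ³, ‖x‖ < δ / lam → φ x = 0 := by
    intro x hx
    have h1 : ‖x‖ < δ := lt_of_lt_of_le hx (div_le_self hδ.le hlam.le)
    have h2 : ‖lam • x‖ < δ := by
      rw [norm_smul, Real.norm_of_nonneg hlam0.le]
      rwa [lt_div_iff₀ hlam0, mul_comm] at hx
    simp [hφ_def, hwl_def, hδw x h1, hδw _ h2]
  have hφ_test : IsTestFunctionOn ⟨{x : ℝ³ | x ≠ 0}, isOpen_ne⟩ φ := by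
    refine ⟨hw.sub hwl, ?_, ?_⟩
    · refine HasCompactSupport.of_support_subset_isCompact (isCompact_closedBall (0 : ℝ³) R₀) ?_
      intro x hx
      rw [mem_closedBall, dist_zero_right]
      by_contra h
      exact hx (hφ_far x (le_of_lt (not_le.mp h)))
    · intro x hx
      change x ≠ 0
      rintro rfl
      have h0 : φ =ᶠ[𝓝 (0 : ℝ³)] 0 := by
        filter_upwards [ball_mem_nhds (0 : ℝ³) (div_pos hδ hlam0)] with y hy
        exact hφ_near y (by simpa using hy)
      exact (notMem_tsupport_iff_eventuallyEq.mpr h0) hx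
  have hφ_div : ∀ x, VectorCalculus.divergence φ x = 0 := by
    intro x
    rw [hφ_def, divergence_sub hwd hwld, hwl_def, divergence_const_smul_comp_smul hwd, hdiv, hdiv]
    ring
  have hE := hEuler φ hφ_test hφ_div
  -- split the pairing with `φ`
  have hpt : ∀ x, ⟪V x, fderiv ℝ φ x (V x)⟫_ℝ =
      ⟪V x, fderiv ℝ w x (V x)⟫_ℝ - ⟪V x, fderiv ℝ wl x (V x)⟫_ℝ := by
    intro x
    rw [hφ_def, fderiv_fun_sub (hwd x) (hwld x)]
    simp [inner_sub_right]
  -- the pairing with `wl`, rescaled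
  set G : ℝ³ → ℝ := fun x => ⟪V x, fderiv ℝ w x (V x)⟫_ℝ with hG_def
  set H : ℝ³ → ℝ := fun y => ⟪V (lam⁻¹ • y), fderiv ℝ w y (V (lam⁻¹ • y))⟫_ℝ with hH_def
  have hHl : ∀ x : ℝ³, ⟪V x, fderiv ℝ wl x (V x)⟫_ℝ = (c * lam) * H (lam • x) := by
    intro x
    simp only [hH_def, hfd x, inner_smul_right, smul_smul, inv_mul_cancel₀ hlam0.ne', one_smul]
  have hae : ∀ᵐ y ∂(volume : Measure ℝ³), H y = lam ^ (4 / 3 : ℝ) * G y := by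
    have hmem : ({(0 : ℝ³)}ᶜ : Set ℝ³) ∈ ae (volume : Measure ℝ³) :=
      compl_mem_ae_iff.2 (measure_singleton _)
    filter_upwards [hmem] with y hy
    have hy' : y ≠ 0 := hy
    simp only [hH_def, hG_def, velocity_inv_smul hlam hDSS hy', map_smul, inner_smul_left,
      inner_smul_right, RCLike.conj_to_real]
    rw [← mul_assoc, ← Real.rpow_add hlam0]
    norm_num
  have hHint : Integrable H := by
    refine (hint.const_mul (lam ^ (4 / 3 : ℝ))).congr ?_
    filter_upwards [hae] with y hy
    exact hy.symm
  have hwlint : Integrable (fun x => ⟪V x, fderiv ℝ wl x (V x)⟫_ℝ) := by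
    have h1 : Integrable (fun x : ℝ³ => H (lam • x)) := hHint.comp_smul hlam0.ne'
    exact (h1.const_mul (c * lam)).congr (Eventually.of_forall fun x => (hHl x).symm)
  have hJ : ∫ x, ⟪V x, fderiv ℝ wl x (V x)⟫_ℝ = (c * lam ^ (-(2 / 3 : ℝ))) * ∫ x, G x := by
    simp_rw [hHl]
    rw [integral_const_mul, Measure.integral_comp_smul volume H lam, integral_congr_ae hae,
      integral_const_mul, finrank_euclideanSpace_fin, smul_eq_mul,
      abs_of_pos (inv_pos.2 (pow_pos hlam0 3)), ← jacobian_factor hlam0]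
    ring
  -- conclude
  have hsplit : ∫ x, ⟪V x, fderiv ℝ φ x (V x)⟫_ℝ =
      (∫ x, G x) - ∫ x, ⟪V x, fderiv ℝ wl x (V x)⟫_ℝ := by
    simp_rw [hpt]
    exact integral_sub hint hwlint
  rw [hsplit, hJ] at hE
  have hfac : c * lam ^ (-(2 / 3 : ℝ)) < 1 := by
    refine mul_lt_one_of_nonneg_of_lt_one_right hc1 (Real.rpow_nonneg hlam0.le _) ?_
    exact Real.rpow_lt_one_of_one_lt_of_neg hlam (by norm_num)
  have hI : (1 - c * lam ^ (-(2 / 3 : ℝ))) * ∫ x, G x = 0 := by linarith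
  rcases mul_eq_zero.mp hI with h | h
  · exact absurd h (by linarith)
  · exact h

/-! ## Zero torque flux in radial-weight form (the falsifier F1 of the card, settled positively) -/

/-- The rotational test fields `w x = g(‖x‖²) A x` (`A` skew): derivative. [folklore] -/
theorem fderiv_radial_smul_skew {g : ℝ → ℝ} (hg : ContDiff ℝ ∞ g) (A : ℝ³ →L[ℝ] ℝ³) (x h : ℝ³) :
    fderiv ℝ (fun y : ℝ³ => g (‖y‖ ^ 2) • A y) x h =
      g (‖x‖ ^ 2) • A h + (deriv g (‖x‖ ^ 2) * (2 * ⟪x, h⟫_ℝ)) • A x := by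
  have hc : HasFDerivAt (fun y : ℝ³ => g (‖y‖ ^ 2))
      (deriv g (‖x‖ ^ 2) • ((2 : ℕ) • innerSL ℝ x)) x :=
    ((hg.differentiable (by simp)) _).hasDerivAt.comp_hasFDerivAt x
      (hasStrictFDerivAt_norm_sq x).hasFDerivAt
  have h := (hc.smul A.hasFDerivAt).fderiv
  rw [show (fun y : ℝ³ => g (‖y‖ ^ 2) • A y) = ((fun y : ℝ³ => g (‖y‖ ^ 2)) • ⇑A) from rfl, h]
  simp only [add_apply, FunLike.coe_smul, Pi.smul_apply, ContinuousLinearMap.smulRight_apply,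
    innerSL_apply_apply]
  simp only [smul_eq_mul, nsmul_eq_mul, Nat.cast_ofNat]

/-- The rotational test fields `w x = g(‖x‖²) A x` (`A` skew) are divergence free:
`div w = g tr A + 2 g' ⟪x, A x⟫ = 0`. [folklore] -/
theorem divergence_radial_smul_skew {g : ℝ → ℝ} (hg : ContDiff ℝ ∞ g) (A : ℝ³ →L[ℝ] ℝ³)
    (hA : ∀ u v : ℝ³, ⟪A u, v⟫_ℝ = -⟪u, A v⟫_ℝ) (x : ℝ³) :
    VectorCalculus.divergence (fun y : ℝ³ => g (‖y‖ ^ 2) • A y) x = 0 := by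
  have hskew0 : ∀ u : ℝ³, ⟪u, A u⟫_ℝ = 0 := fun u => by
    have h := hA u u
    rw [real_inner_comm] at h
    linarith
  rw [divergence_eq_sum_inner_fderiv (EuclideanSpace.basisFun (Fin 3) ℝ)]
  simp_rw [fderiv_radial_smul_skew hg A, inner_add_right, inner_smul_right, hskew0, mul_zero,
    zero_add]
  have hsum : ∑ i, deriv g (‖x‖ ^ 2) * (2 * ⟪x, (EuclideanSpace.basisFun (Fin 3) ℝ) i⟫_ℝ) *
      ⟪(EuclideanSpace.basisFun (Fin 3) ℝ) i, A x⟫_ℝ =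
      deriv g (‖x‖ ^ 2) * 2 * ∑ i, ⟪x, (EuclideanSpace.basisFun (Fin 3) ℝ) i⟫_ℝ *
        ⟪(EuclideanSpace.basisFun (Fin 3) ℝ) i, A x⟫_ℝ := by
    rw [Finset.mul_sum]
    refine Finset.sum_congr rfl fun i _ => ?_
    ring
  rw [hsum, OrthonormalBasis.sum_inner_mul_inner, hskew0, mul_zero]

/-- **Zero torque flux of a pressure-free DSS weak Euler cone (radial-weight form).** For `V` as in
`pairing_eq_zero` with `|V|²` locally integrable off the origin, every skew `A` and every smooth
radial profile `g` vanishing on `(-∞, a]` (`a > 0`) and constant on `[b, ∞)`: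
`∫ g'(‖x‖²) ⟪V x, x⟫ ⟪V x, A x⟫ dx = 0`. Since `g(b)` is arbitrary, `g'` ranges over ALL of
`C_c^∞((0,∞))` (not only over derivatives of compactly supported profiles, which is what the weak
Euler identity gives directly): the torque flux `∮_{S_ρ} ⟪V,n⟫⟪V, A x⟫ dσ` of the cone vanishes for
a.e. `ρ`, the angular-momentum compatibility of compactly supported symmetric anti-divergence
correctors on shells (tree: `Literature.Geometry.Lorentzian.MaoOhTao.sum_pd_annulusT_eq`,
hypothesis `hmom`). Test field `w = g(‖x‖²) A x`, `c = λ⁻¹` in `pairing_eq_zero`; the pairing is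
`⟪V, Dw V⟫ = 2 g'(‖x‖²)⟪x, V⟫⟪V, A x⟫` because `⟪V, A V⟫ = 0`. [folklore] -/
theorem torqueFlux_eq_zero {lam : ℝ} {V : ℝ³ → ℝ³} (hlam : 1 < lam)
    (hVm : AEStronglyMeasurable V volume)
    (hDSS : ∀ x : ℝ³, x ≠ 0 → V (lam • x) = lam ^ (-(2 / 3 : ℝ)) • V x)
    (hVloc : LocallyIntegrableOn (fun x => ‖V x‖ ^ 2) {x : ℝ³ | x ≠ 0} volume)
    (hEuler : ∀ φ : ℝ³ → ℝ³, IsTestFunctionOn ⟨{x : ℝ³ | x ≠ 0}, isOpen_ne⟩ φ →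
      (∀ x, VectorCalculus.divergence φ x = 0) → ∫ x, ⟪V x, fderiv ℝ φ x (V x)⟫_ℝ = 0)
    (A : ℝ³ →L[ℝ] ℝ³) (hA : ∀ u v : ℝ³, ⟪A u, v⟫_ℝ = -⟪u, A v⟫_ℝ)
    {g : ℝ → ℝ} (hg : ContDiff ℝ ∞ g) {a b : ℝ} (ha : 0 < a) (hab : a ≤ b)
    (hga : ∀ t, t ≤ a → g t = 0) (hgb : ∀ t, b ≤ t → g t = g b) :
    ∫ x, deriv g (‖x‖ ^ 2) * ⟪V x, x⟫_ℝ * ⟪V x, A x⟫_ℝ = 0 := by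
  have hlam0 : (0 : ℝ) < lam := by linarith
  have hb : 0 < b := lt_of_lt_of_le ha hab
  have hskew0 : ∀ u : ℝ³, ⟪u, A u⟫_ℝ = 0 := fun u => by
    have h := hA u u
    rw [real_inner_comm] at h
    linarith
  set w : ℝ³ → ℝ³ := fun y => g (‖y‖ ^ 2) • A y with hw_def
  have hw : ContDiff ℝ ∞ w := (hg.comp (contDiff_norm_sq ℝ)).smul A.contDiff
  have hpair : ∀ x, ⟪V x, fderiv ℝ w x (V x)⟫_ℝ =
      2 * (deriv g (‖x‖ ^ 2) * ⟪V x, x⟫_ℝ * ⟪V x, A x⟫_ℝ) := by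
    intro x
    rw [hw_def, fderiv_radial_smul_skew hg A, inner_add_right, inner_smul_right, inner_smul_right,
      hskew0, real_inner_comm x]
    ring
  -- `g'` vanishes off `[a, b]`
  have hderiv0 : ∀ t, t ∉ Set.Icc a b → deriv g t = 0 := by
    intro t ht
    rw [Set.mem_Icc, not_and_or, not_le, not_le] at ht
    rcases ht with ht | ht
    · have h : g =ᶠ[𝓝 t] fun _ => (0 : ℝ) :=
        Filter.eventually_of_mem (Iio_mem_nhds ht) fun s hs => hga s (le_of_lt hs)
      rw [h.deriv_eq, deriv_const]
    · have h : g =ᶠ[𝓝 t] fun _ => g b :=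
        Filter.eventually_of_mem (Ioi_mem_nhds ht) fun s hs => hgb s (le_of_lt hs)
      rw [h.deriv_eq, deriv_const]
  -- integrability of the pairing: it lives on the shell `√a ≤ ‖x‖ ≤ √b` and is `O(|V|²)` there
  have hint0 : Integrable (fun x => deriv g (‖x‖ ^ 2) * ⟪V x, x⟫_ℝ * ⟪V x, A x⟫_ℝ) := by
    set K : Set ℝ³ := {x : ℝ³ | Real.sqrt a ≤ ‖x‖ ∧ ‖x‖ ≤ Real.sqrt b} with hK_def
    have hKc : IsCompact K :=
      Metric.isCompact_of_isClosed_isBounded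
        ((isClosed_le continuous_const continuous_norm).inter
          (isClosed_le continuous_norm continuous_const))
        ((isBounded_closedBall (x := (0 : ℝ³)) (r := Real.sqrt b)).subset
          fun x hx => by simpa using hx.2)
    have hKsub : K ⊆ {x : ℝ³ | x ≠ 0} := by
      intro x hx h0
      have h1 : 0 < Real.sqrt a := Real.sqrt_pos.2 ha
      have h2 : Real.sqrt a ≤ ‖x‖ := hx.1
      rw [h0, norm_zero] at h2
      linarith
    have hKm : MeasurableSet K :=
      (measurableSet_le measurable_const measurable_norm).inter
        (measurableSet_le measurable_norm measurable_const)
    have hVK : Integrable (K.indicator fun x => ‖V x‖ ^ 2) :=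
      (hVloc.integrableOn_compact_subset hKsub hKc).integrable_indicator hKm
    obtain ⟨M, hM⟩ : ∃ M, ∀ t ∈ Set.Icc a b, ‖deriv g t‖ ≤ M :=
      isCompact_Icc.exists_bound_of_continuousOn (hg.continuous_deriv (by simp)).continuousOn
    have hM0 : 0 ≤ M := le_trans (norm_nonneg _) (hM a ⟨le_rfl, hab⟩)
    refine Integrable.mono' (hVK.const_mul (M * b * ‖A‖)) ?_ ?_
    · exact ((((hg.continuous_deriv (by simp)).comp
          (continuous_norm.pow 2)).aestronglyMeasurable.mul
        (hVm.inner aestronglyMeasurable_id)).mul (hVm.inner A.continuous.aestronglyMeasurable))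
    · refine Eventually.of_forall fun x => ?_
      by_cases hx : x ∈ K
      · have hx2 : ‖x‖ ^ 2 ∈ Set.Icc a b := by
          constructor
          · calc a = Real.sqrt a ^ 2 := (Real.sq_sqrt ha.le).symm
              _ ≤ ‖x‖ ^ 2 := pow_le_pow_left₀ (Real.sqrt_nonneg a) hx.1 2
          · calc ‖x‖ ^ 2 ≤ Real.sqrt b ^ 2 := pow_le_pow_left₀ (norm_nonneg x) hx.2 2
              _ = b := Real.sq_sqrt hb.le
        rw [Set.indicator_of_mem hx]
        have h1 : |⟪V x, x⟫_ℝ| ≤ ‖V x‖ * ‖x‖ := abs_real_inner_le_norm _ _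
        have h2 : |⟪V x, A x⟫_ℝ| ≤ ‖V x‖ * (‖A‖ * ‖x‖) :=
          (abs_real_inner_le_norm _ _).trans
            (mul_le_mul_of_nonneg_left (A.le_opNorm x) (norm_nonneg _))
        have h3 : ‖x‖ ^ 2 ≤ b := hx2.2
        have h4 : |deriv g (‖x‖ ^ 2)| ≤ M := by simpa using hM _ hx2
        rw [Real.norm_eq_abs, abs_mul, abs_mul]
        calc |deriv g (‖x‖ ^ 2)| * |⟪V x, x⟫_ℝ| * |⟪V x, A x⟫_ℝ|
            ≤ M * (‖V x‖ * ‖x‖) * (‖V x‖ * (‖A‖ * ‖x‖)) := by gcongr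
          _ = M * ‖x‖ ^ 2 * ‖A‖ * ‖V x‖ ^ 2 := by ring
          _ ≤ M * b * ‖A‖ * ‖V x‖ ^ 2 := by gcongr
      · have hx2 : ‖x‖ ^ 2 ∉ Set.Icc a b := by
          intro h
          apply hx
          constructor
          · exact (Real.sqrt_le_sqrt h.1).trans_eq (Real.sqrt_sq (norm_nonneg x))
          · exact (Real.sqrt_sq (norm_nonneg x)).symm.le.trans (Real.sqrt_le_sqrt h.2)
        rw [hderiv0 _ hx2, Set.indicator_of_notMem hx]
        simp
  have hint : Integrable (fun x => ⟪V x, fderiv ℝ w x (V x)⟫_ℝ) := by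
    rw [show (fun x => ⟪V x, fderiv ℝ w x (V x)⟫_ℝ) =
        fun x => 2 * (deriv g (‖x‖ ^ 2) * ⟪V x, x⟫_ℝ * ⟪V x, A x⟫_ℝ) from funext hpair]
    exact hint0.const_mul 2
  -- the remaining hypotheses of the abstract lemma
  have h0 : ∃ δ : ℝ, 0 < δ ∧ ∀ x : ℝ³, ‖x‖ < δ → w x = 0 := by
    refine ⟨Real.sqrt a, Real.sqrt_pos.2 ha, fun x hx => ?_⟩
    have : ‖x‖ ^ 2 < a := (Real.lt_sqrt (norm_nonneg x)).1 hx
    simp [hw_def, hga _ this.le]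
  have hinf : ∃ R₀ : ℝ, ∀ x : ℝ³, R₀ ≤ ‖x‖ → lam⁻¹ • w (lam • x) = w x := by
    refine ⟨Real.sqrt b, fun x hx => ?_⟩
    have hxb : b ≤ ‖x‖ ^ 2 := by
      calc b = Real.sqrt b ^ 2 := (Real.sq_sqrt hb.le).symm
        _ ≤ ‖x‖ ^ 2 := pow_le_pow_left₀ (Real.sqrt_nonneg b) hx 2
    have hxb' : b ≤ ‖lam • x‖ ^ 2 := by
      rw [norm_smul, Real.norm_of_nonneg hlam0.le, mul_pow]
      calc b ≤ ‖x‖ ^ 2 := hxb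
        _ = 1 * ‖x‖ ^ 2 := (one_mul _).symm
        _ ≤ lam ^ 2 * ‖x‖ ^ 2 := by gcongr; nlinarith
    simp only [hw_def, map_smul, smul_smul, hgb _ hxb, hgb _ hxb']
    congr 1
    field_simp
  have key := pairing_eq_zero hlam hDSS hEuler hw (divergence_radial_smul_skew hg A hA)
    (inv_le_one_of_one_le₀ hlam.le) h0 hinf hint
  simp_rw [hpair] at key
  rw [integral_const_mul] at key
  linarith

end DSSEulerCone

end Literature.Analysis.FluidPDE

end
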